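/-
Copyright (c) 2026 the pub-hodgecm-mathlib formalisation cell (harness21).  Prover seat hodgecm-mathlib-K2E5-p16 (g6), Track B «K2-LIT»,
#184♮ = hLiu418 = `stmt-HodgeConjecture-24832`; S2-asm road (γ), K2Liu-p05 (g5)'s FILE 3 census 8b94751112c33a29 gap (G4) «SIGN PATTERNS REALISED»
(dealt K2E5-plan (g7) 14:10:36Z): every sign pattern at the infinite places of a number field is the sign pattern of a nonzero element —
weak approximation at the infinite places (Mathlib `NumberField.InfinitePlace.denseRange_algebraMap_pi`).  THEOREMS ONLY.
-/
import Mathlib.NumberTheory.NumberField.InfinitePlace.Basic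
import HarnessLib

/-!
# Crux `HLiu418`, S2-asm (γ) gap (G4): sign patterns at the infinite places are realised by nonzero field elements

Cell `hodgecm-mathlib`, crux item hLiu418 = `stmt-HodgeConjecture-24832` (helper lane `--supports`, count-neutral).

* `re_neg_of_norm_add_one_lt`, `re_pos_of_norm_sub_one_lt` — `‖z + 1‖ < 1 ⇒ re z < 0`, `‖z − 1‖ < 1 ⇒ 0 < re z`;
* **`exists_ne_zero_re_embedding_neg_iff`** — for every `T : Finset (InfinitePlace K)`: `∃ c : K, c ≠ 0 ∧ ∀ w, (w.embedding c).re < 0 ↔ w ∈ T`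
  (the `(T, c, hc0, sign)` binder of ★ σ17 `ArchSWRegionSpanning` ∕ FILE 3: approximate `(∓1)_w` within `1` at every place).
References: [Neukirch1999, Ch. II (3.4) (approximation theorem)].
HONEST LABEL: HC_CM is proved only modulo the 7 printed citations (2 remaining named inputs: hLiu418 = stmt-HodgeConjecture-24832,
h413 = stmt-HodgeConjecture-24833) until rung 0 closes; count-neutral helper, closes no socket.
-/

set_option autoImplicit false
set_option linter.dupNamespace false

noncomputable section

open NumberField NumberField.InfinitePlace

namespace Summit.HodgeConjecture.HodgeConjecture.Cruxes.HLiu418.K2LiuRealSignPatternsRealised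

/-- `‖z + 1‖ < 1 ⇒ re z < 0`. [folklore] -/
theorem re_neg_of_norm_add_one_lt {z : ℂ} (h : ‖z + 1‖ < 1) : z.re < 0 := by
  have h1 := Complex.abs_re_le_norm (z + 1)
  rw [Complex.add_re, Complex.one_re] at h1
  have h2 : |z.re + 1| < 1 := lt_of_le_of_lt h1 h
  rw [abs_lt] at h2
  linarith [h2.2]

/-- `‖z − 1‖ < 1 ⇒ 0 < re z`. [folklore] -/
theorem re_pos_of_norm_sub_one_lt {z : ℂ} (h : ‖z - 1‖ < 1) : 0 < z.re := by
  have h1 := Complex.abs_re_le_norm (z - 1)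
  rw [Complex.sub_re, Complex.one_re] at h1
  have h2 : |z.re - 1| < 1 := lt_of_le_of_lt h1 h
  rw [abs_lt] at h2
  linarith [h2.1]

/-- **SIGN PATTERNS AT THE INFINITE PLACES ARE REALISED**: for every finite set `T` of infinite places of a number field `K` there is `c ≠ 0` in `K`
with `re (w.embedding c) < 0` exactly for `w ∈ T` (weak approximation at the infinite places: approximate `−1` at the places of `T` and `1`
at the others within distance `1`). [cite: Neukirch1999, Ch. II (3.4)]  -/
theorem exists_ne_zero_re_embedding_neg_iff (K : Type*) [Field K] [NumberField K] (T : Finset (InfinitePlace K)) :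
    ∃ c : K, c ≠ 0 ∧ ∀ w : InfinitePlace K, (w.embedding c).re < 0 ↔ w ∈ T := by
  classical
  -- the target point `(∓1)_v` and the open box of radius `1` around it
  let x : ∀ v : InfinitePlace K, WithAbs v.1 := fun v => WithAbs.toAbs v.1 (if v ∈ T then -1 else 1)
  have hU : IsOpen (Set.pi Set.univ fun v : InfinitePlace K => Metric.ball (x v) 1) :=
    isOpen_set_pi Set.finite_univ fun v _ => Metric.isOpen_ball
  have hne : (Set.pi Set.univ fun v : InfinitePlace K => Metric.ball (x v) 1).Nonempty :=
    ⟨x, fun v _ => Metric.mem_ball_self one_pos⟩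
  obtain ⟨c, hc⟩ := (denseRange_algebraMap_pi (K := K)).exists_mem_open hU hne
  -- `v (c − (∓1)) < 1` at every place
  have hcv : ∀ v : InfinitePlace K, v (c - (if v ∈ T then -1 else 1)) < 1 := by
    intro v
    have h := hc v (Set.mem_univ v)
    rw [Metric.mem_ball, dist_eq_norm, Pi.algebraMap_apply, WithAbs.algebraMap_right_apply, Algebra.algebraMap_self,
      RingHom.id_apply] at h
    change ‖WithAbs.toAbs v.1 c - WithAbs.toAbs v.1 (if v ∈ T then -1 else 1)‖ < 1 at h
    rwa [← WithAbs.toAbs_sub, WithAbs.norm_toAbs_eq] at h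
  refine ⟨c, ?_, fun w => ?_⟩
  · rintro rfl
    obtain ⟨v⟩ := (inferInstance : Nonempty (InfinitePlace K))
    have h := hcv v
    rw [← norm_embedding_eq, map_sub, map_zero, zero_sub, norm_neg] at h
    by_cases hvT : v ∈ T
    · rw [if_pos hvT, map_neg, map_one, norm_neg, norm_one] at h
      exact lt_irrefl _ h
    · rw [if_neg hvT, map_one, norm_one] at h
      exact lt_irrefl _ h
  · have h := hcv w
    rw [← norm_embedding_eq, map_sub] at h
    by_cases hwT : w ∈ T
    · rw [if_pos hwT, map_neg, map_one, sub_neg_eq_add] at h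
      exact ⟨fun _ => hwT, fun _ => re_neg_of_norm_add_one_lt h⟩
    · rw [if_neg hwT, map_one] at h
      exact ⟨fun hneg => absurd (re_pos_of_norm_sub_one_lt h) (not_lt.2 hneg.le), fun hw => absurd hw hwT⟩

end Summit.HodgeConjecture.HodgeConjecture.Cruxes.HLiu418.K2LiuRealSignPatternsRealised

end
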